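import Summits.BirchSwinnertonDyer.BirchSwinnertonDyer.Theorems.KolyvaginRankRigidityAtTwoOffHabitatIrredChebotarevOneClassFiniteIndex
import Summits.BirchSwinnertonDyer.BirchSwinnertonDyer.Theorems.KolyvaginRankRigidityAtTwoOffHabitatIrredSimpleTwoOfNoTwoTorsion
import Summits.BirchSwinnertonDyer.BirchSwinnertonDyer.Theorems.KolyvaginRankRigidityAtTwoOffHabitatIrredInflationDefectOfOpenImage
import HarnessLib

/-!
# Route `KolyvaginRankRigidityAtTwo`, residual crux R_irr `OffHabitatIrredNonSurjTwoConverse`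
# (stmt-BirchSwinnertonDyer-27123, LINE 8 «margin absorbs index»): ONE-CLASS ČEBOTAREV AT `2`
# ON THE FRAME OF R_irr — `E(ℚ)[2] = 0`, ANY `2`-adic index — modulo Serre's open image theorem
# (helper, PROVED modulo the named fact `serre_adicImage_contains_congruenceSubgroup`;
# width seat `bsd-line-krr2-p2` g9)

Assembly of the three finite-index inputs landed this generation:
`exists_kolyvaginPrime_gt_two_eigenclass_of_inflationDefect` (abstract defect `k`, loss `k + 1`),
`simple_two_of_torsionBy_eq_bot` (`hS` from `E(ℚ)[2] = 0`), `inflationDefect_of_serre` (`hSah`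
with `k` uniform in the level, from Serre). Result `exists_kolyvaginPrime_gt_two_eigenclass_offHabitat`:
for non-CM `E = W/ℚ` (globally minimal) with `E(ℚ)[2] = 0` and `K` imaginary quadratic there is a
DEFECT `k = k(E, K)` such that for all levels `1 ≤ M ≤ M'`, every `κ ∈ H¹(K, E[2^M])` with
`c_* κ = ε κ` and `2^{m-1} κ ≠ 0` admits, above every bound, Kolyvagin primes `ℓ` at `2` with
`M' ≤ M(ℓ)` at whose place `2^j κ` (`j + k + 2 ≤ m`) is not locally trivial — the S2 / T5b(a′)
Čebotarev input of the KRR engine OFF the surjective habitat, with the `2`-adic index absorbed by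
`k` further bits of margin (the window-step form with `M + 1 ≤ M(q)` and defect `D = k + 1` is
`exists_kolyvaginPrime_notMem_two_eigenclass_offHabitat`). This is the kernel form of LINE 8's
mechanism «Kolyvagin primes of every depth exist because τ lies in the image … the bounded image
defect is paid for by the margin» for its Čebotarev half.

HONEST FRAMING: helper (`--supports` 27123), CONDITIONAL on `serre_adicImage_contains_congruenceSubgroup`
(in print, not proved in the tree). The finite-index SWAP ENGINE (S1L), the eigen-sign input T3,
Kolyvagin's conjecture at `2` (U1) and Gross 3.7(2) (23091) are untouched; R_irr is NOT closed;
BSD is NOT proved by any of this.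

References: [McCallumLMS1991] §3 Cor. 3.2; [Kolyvagin1991MathAnn] §2 (finite index);
[SilvermanAEC2009] Thm. III.7.9 (a); [Sah1968] Prop. 2.7 (b); [RouseZureickBrown2015].
-/

set_option autoImplicit false
-- the Theorems namespace of this sub repeats the summit name by design (D-0017 nested layout)
set_option linter.dupNamespace false

noncomputable section

open scoped Classical

namespace Summit.BirchSwinnertonDyer.BirchSwinnertonDyer.Theorems.KolyvaginLowerBoundAtTwo

open WeierstrassCurve Field NumberField IsDedekindDomain
open Literature.NumberTheory.GaloisRepresentations Literature.NumberTheory.EllipticCurves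
open Literature.NumberTheory

universe u

variable {W : WeierstrassCurve ℚ}

/-- **One-class Čebotarev at `2` on the frame of R_irr, one level up, modulo Serre's open image.**
For non-CM `E = W/ℚ` (globally minimal) with `E(ℚ)[2] = 0` and `K` imaginary quadratic (`c ≠ 1`
in `Aut(K/ℚ)`), there is `k` such that: for all `1 ≤ M ≤ M'`, every `κ ∈ H¹(K, E[2^M])` with
`c_* κ = ε κ` (`ε = ±1`) and `2^{m-1} κ ≠ 0`, and every bound `b`, there is a Kolyvagin prime
`ℓ > b` at `2` with `M' ≤ M(ℓ)`, `Frob ℓ = Frob ∞` on `K(E[2^{M'}])`, at whose place the classes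
`2^j κ`, `j + k + 2 ≤ m`, are not locally trivial. NO surjectivity of the `2`-adic tower.
[cite: McCallumLMS1991, §3 Cor. 3.2] [cite: SilvermanAEC2009, Thm. III.7.9 (a)]
[cite: Kolyvagin1991MathAnn, §2] -/
theorem exists_kolyvaginPrime_gt_two_eigenclass_offHabitat
    (hSerre : serre_adicImage_contains_congruenceSubgroup) {N : ℕ} [NeZero N] [W.IsElliptic]
    [W.IsGloballyMinimal] (hCM : ¬ W.HasCM)
    (htorQ : AddSubgroup.torsionBy W.toAffine.Point (2 : ℤ) = ⊥)
    {K : Type} [Field K] [NumberField K] (hK : IsImaginaryQuadratic K) {c : K ≃ₐ[ℚ] K} (hc : c ≠ 1) :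
    ∃ k : ℕ, ∀ (M M' : ℕ), 1 ≤ M → M ≤ M' →
      ∀ (κ : galH1Torsion (W.baseChange K) ((2 ^ M : ℕ) : ℤ)) (ε : ℤ), (ε = 1 ∨ ε = -1) →
        conjAct W c ((2 ^ M : ℕ) : ℤ) κ = ε • κ → ∀ m : ℕ, (2 : ℤ) ^ (m - 1) • κ ≠ 0 → ∀ b : ℕ,
          ∃ ℓ : ℕ, b < ℓ ∧ Zhang2014.IsKolyvaginPrime N W K 2 ℓ ∧
            M' ≤ Zhang2014.kolyvaginIndex W 2 ℓ ∧ FrobEqFrobInfty W K (2 ^ M') ℓ ∧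
            ∀ v : HeightOneSpectrum (𝓞 K), (ℓ : 𝓞 K) ∈ v.asIdeal → ∀ j : ℕ, j + k + 2 ≤ m →
              ((2 ^ j : ℕ) : ℤ) • κ ∉
                (W.baseChange K).torsionLocalKer (v.adicCompletion K) ((2 ^ M : ℕ) : ℤ) := by
  obtain ⟨k, hk⟩ := inflationDefect_of_serre hSerre W hCM K hK.1
  refine ⟨k, fun M M' hM hMM' κ ε hε hκ m hm b ↦ ?_⟩
  exact exists_kolyvaginPrime_gt_two_eigenclass_of_inflationDefect (N := N) hK
    (simple_two_of_torsionBy_eq_bot W htorQ K hK) hc hM hMM' (hk M M' hMM') κ hε hκ hm b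

/-- **Window-step form on the frame of R_irr** (margin `M + 1 ≤ M(q)`, defect `D = k + 1`): with
`k` as above, for every `κ ∈ H¹(K, E[2^M])` (`c_* κ = ε κ`, `2^{e'} κ ≠ 0` for `e' + e < M`) and
finite set `S` there is a Kolyvagin prime `q ∉ S` at `2` with `M + 1 ≤ M(q)` and a place `v ∋ q`
where `2^{e'} κ` is not locally trivial whenever `e' + e + k + 1 < M`.
[cite: Kolyvagin1991MathAnn, §2 (proof of Thm. 2.2)] [cite: McCallumLMS1991, §3 Cor. 3.2] -/
theorem exists_kolyvaginPrime_notMem_two_eigenclass_offHabitat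
    (hSerre : serre_adicImage_contains_congruenceSubgroup) {N : ℕ} [NeZero N] [W.IsElliptic]
    [W.IsGloballyMinimal] (hCM : ¬ W.HasCM)
    (htorQ : AddSubgroup.torsionBy W.toAffine.Point (2 : ℤ) = ⊥)
    {K : Type} [Field K] [NumberField K] (hK : IsImaginaryQuadratic K) {c : K ≃ₐ[ℚ] K} (hc : c ≠ 1) :
    ∃ k : ℕ, ∀ (M : ℕ), 1 ≤ M →
      ∀ (κ : galH1Torsion (W.baseChange K) ((2 ^ M : ℕ) : ℤ)) (ε : ℤ), (ε = 1 ∨ ε = -1) →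
        conjAct W c ((2 ^ M : ℕ) : ℤ) κ = ε • κ →
        ∀ e : ℕ, (∀ e' : ℕ, e' + e < M → ((2 ^ e' : ℕ) : ℤ) • κ ≠ 0) → ∀ S : Finset ℕ,
          ∃ q : ℕ, q ∉ S ∧ Zhang2014.IsKolyvaginPrime N W K 2 q ∧
            M + 1 ≤ Zhang2014.kolyvaginIndex W 2 q ∧
            ∃ v : HeightOneSpectrum (𝓞 K), ((q : ℕ) : 𝓞 K) ∈ v.asIdeal ∧
              ∀ e' : ℕ, e' + e + k + 1 < M →
                ((2 ^ e' : ℕ) : ℤ) • κ ∉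
                  (W.baseChange K).torsionLocalKer (v.adicCompletion K) ((2 ^ M : ℕ) : ℤ) := by
  obtain ⟨k, hk⟩ := inflationDefect_of_serre hSerre W hCM K hK.1
  refine ⟨k, fun M hM κ ε hε hκ e hord S ↦ ?_⟩
  exact exists_kolyvaginPrime_notMem_two_eigenclass_of_inflationDefect (N := N) hK
    (simple_two_of_torsionBy_eq_bot W htorQ K hK) hc hM (hk M (M + 1) (Nat.le_succ M)) κ hε hκ
    hord S

end Summit.BirchSwinnertonDyer.BirchSwinnertonDyer.Theorems.KolyvaginLowerBoundAtTwo

end
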